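import Summits.AtomisticToContinuum.Crystallization.Theorems.FrustratedLawDichotomyStrainedPatchStiffSector

/-!
(SPLIT FOR THE 400-LINE CAP by the landing lane, hand-2 g41: this file = part 1 of 2; sequels `…FrustratedLawDichotomyStrainedPatchStiffDoor` import it in a chain; same namespace, all FQNs unchanged.)
# Strained patch — «StiffDoor»: the host-sector predicates TYPED (door · spectral · dilated · deep), the THREE-SECTOR cut of (N) at one host-graded table,
# the E-pricing of the pair-blind (dilated) sector, and the linear-response first lemma with explicit `Λ₀`

decomp-a2c lens-5 g95 NODE SKETCH (crux `AperiodicFrustratedLawGap`, stmt-AtomisticToContinuum-27623, T-side [CORE-FAR]; chain 87C «ConeAnatomy» (p854143) →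
94Σ «StiffSector» (tree …StrainedPatchStiffSector); lens «finite/base range + asymptotic regime + bridge»; critic row 1567 (6): (a) 𝓟 typed — spectral vs door vs
disjunction, (b) E-PRICING SPEC of the pair-blind soft classes, (c) first lemma of (N|𝓟) = BASIN-87's linear term with explicit `Λ₀`).

THE FINDING «E-PRICE-95» (desk, zero kit; `decomp-a2c-lens-5/g95/num/eprice95.py|.out`, tree potential `W₄₅ = effPot w₄₅ ω₄ (3/400)`, level `e = −0.7175 + 3/400`,
`κ_T = 10⁻³`).  The PAIR-BLIND E-cell of a host (scalar `1/25` chart, no pair table: bond deviations `≤ 1/25` at the centre, `≤ 2/25` elsewhere) has the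
pair-DECOUPLED lower bound `x ≥ ½·Σ_k min_{|t| ≤ 2/25} W(ρ_k + t) − e` which, on homogeneous fcc-type hosts of nearest-neighbour distance `d`, reads
`−0.109 / −0.090 / −0.072 / −0.039 / −0.011 / +0.002 / +0.012 / +0.036 / +0.056 / +0.080 / +0.165` per site at `d = 0.96 / 0.97 / 0.98 / 1.00 / 1.02 / 1.03 /
1.04 / 1.06 / 1.08 / 1.10 / 1.15` (host surplus itself `+0.003 … +0.289`; W94c-type anisotropic host `+0.070`; Bain-strained hosts at volumetric `1.04`:
`+0.009 … +0.012`).  HENCE the soft sector of SHUFFLE-94 is pair-blind-AFFORDABLE exactly on its DILATED part `d ≥ 26/25` (where all three SHUFFLE-94 witnesses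
live: host stretches `1.08–1.16`), by the crudest certificate (no joint minimisation), margin `≥ +0.0116 − 13κ_T`/site; and it is NOT affordable on the
BAND `24/25 < d < 26/25` (decoupled bound `−0.09 … −0.001`), where the regime map of g94 (§2.3) puts a populated soft part (`η` above the diagonal
`(0.98, 0.087) … (1.03, 0.063)`; soft fractions `0.24 / 0.40 / 0.49` of the sampled hosts by density bin) whose NECESSARY cone floor N94 is `2·A_clean − bend
≈ 0.034–0.046 >` every record cone (`0.021–0.031`).  So the honest host map has THREE sectors, not two:
  𝔇 DOOR      `Door (24/25) (9/100)` = a neighbour within `24/25` ∧ centre `9/100`-good (sample: `Λ_D ≥ 2.1`; contains FZ00/FZ62/FZ09) — RECORD CONES;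
               (N|𝔇) [ANALYTIC · IDEA-NEEDED], first lemma `linearResponse_l2` below (explicit `Λ₀`; the SPECTRAL predicate `Stiff hessBlk0 (63/10) Λ₀` is typed
               here as the hypothesis the proof really uses — the door is its census proxy); E: the existing FZ boxes.
  𝔄 DILATED   `¬Dense (26/25)` = every other site at distance `≥ 26/25` — PAIR-BLIND: (N|𝔄) PROVED FREE (g94 `refineGB_famAndNot_free`), (E|𝔄) =
               `TubeFloor (𝓘 ∧ ¬Dense (26/25)) (1/25)` EXACTLY (`tubeFloorGB_kinematic_iff`, `tubeFloor_dilated_of_recBy`) [CERTIFICATE · ATTACKABLE by the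
               decoupled bound; census target «E-DIL-95»].
  𝔅 BAND      the rest (`Dense (26/25) ∧ ¬Door`; contains the clean-capped corner `Deep (21/200)`, FZ12-type, and the soft mid-density band) — HOST-GRADED WIDE
               cone `βf = N94 law ≈ 2·min(σ₁/Λ_D⁺, A_clean, 1/25) + bend + slack` (`0.04–0.06` on its soft part, record cones on its stiff part);
               (N|𝔅) [ANALYTIC · IDEA-NEEDED · KILL-WARNING at record cones]; (E|𝔅) [INSTRUMENTABLE-JOINT: decoupled-negative, needs the quadratic
               (Hessian) certificate of the g86 kernel machinery on the E-side].
THE CUT (this file, by construction; one common host-graded table on the dense side, so no sector-matching between coarse and hull hosts is needed):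
  (D_GB⋆ by host)(𝓘₀ → 𝓘; `βf⋆ = stepByF (Dense dA) (stepByF 𝓡 βf₁ βf₂) (2/25)`, `sf⋆` likewise)
      ⟸ (N|𝔇) `RefineGB (famAnd (famAnd 𝓘₀ (Dense dA)) 𝓡) 𝓗 … (relConeBy 2 βf sf (1/25))` ∧ (N|𝔅) `RefineGB (famAndNot (famAnd 𝓘₀ (Dense dA)) 𝓡) 𝓗 … (same table)`
        ∧ dilated coarse hosts are hull hosts ∧ `𝓗 ≤ 𝓘` ∧ the cone is capped (`≤ 2/25`)                                   — `refineGBRecByAt_threeSector`;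
  (TF-GB⋆ by host)(𝓘; βf⋆, sf⋆) ⟸ (E|𝔇) ∧ (E|𝔅) at their cones ∧ (E|𝔄) `TubeFloor (famAndNot 𝓘 (Dense dA)) (1/25)`     — `tubeFloorGBRecBy_threeSector`;
  and the crux BY NAME from the six cells + the record's other leaves — `aperiodicFrustratedLawGap_of_threeSector_A35000_T26_record`.
Every piece is strictly weaker than its parent ((N) ⟹ each restriction: `refineGB_iff_two_sectors`; (E|𝔄) is NECESSARY: `tubeFloor_dilated_of_recBy`).
(F) of 87C is DISCHARGED in this reading (`𝓗 ≤ 𝓘`, same data both sides: `RefineGB.mono`); the shadow form is kept (`refineGBRecByAt_threeSector_of_shadows`).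

THE FIRST LEMMA OF (N|𝔇) (critic (c)): `Stiff H R Λ₀` = the clamped-cluster energy form `quadForm H` (`H = ∂F/∂y`, designated table `hessBlk0`) is
`Λ₀`-coercive on `R`-ball-supported displacement fields; `linearResponse_l2`: force balance `Σ_b H(a,b) u_b = −g_a` ⟹ `Λ₀²·Σ‖u_a‖² ≤ Σ‖g_a‖²`
(Lax–Milgram / Cauchy–Schwarz; with `‖g_a‖ ≤ σ₁(1 + X̄)` this is BASIN-87's `A = g·σ₁(1 + X̄)` with the ℓ² gain `g₂ = 1/Λ₀`); `linearResponse_site` the per-site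
reading (lossy by the site count: the ℓ^∞ gain — exponential decay of `H⁻¹` for banded coercive `H`, Demko–Moss–Smith type — is the NEXT lemma of the line,
not claimed here); `amplitude_le_of_sq` the one-mode (frozen zone-boundary phonon) reading `A ≤ σ/Λ₀`, i.e. the N94 floor `2σ₁/Λ_D` from the other side; §1b the
BOND form: `StiffGrad H R ℓ Λ₁` (Korn-type: energy ≥ `Λ₁ ×` bond-gradient energy `gradSq`), `gradResponse_l2` / `bondResponse` (`Λ₁²·‖u a − u b‖² ≤ Ψ₂`,
`Ψ₂` the squared graph-`H⁻¹` seminorm of `g`) with the desk table «LAMBDA-95» of `Λ₁(d)` (binding mode = slow transverse long wave; shear-unstable at `d ≈ 1.075`).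
[formal bookkeeping] 0 sorry · no new axioms · no cite tokens · no instances / notation.
-/

open scoped BigOperators Classical RealInnerProductSpace
open Summit.AtomisticToContinuum.Crystallization.Theorems.ChargedEnergyGapNegative (eStar E3)
open Summit.AtomisticToContinuum.Crystallization.Theorems.FrustratedLawDichotomyRangeCut
open Summit.AtomisticToContinuum.Crystallization.Theorems.FrustratedLawDichotomySchurCut
open Summit.AtomisticToContinuum.Crystallization.Theorems.FrustratedLawDichotomyMotifLemmas (GoodAtScale)
open Summit.AtomisticToContinuum.Crystallization.Theorems.FrustratedLawDichotomyAveragingCut (ballAvg)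
open Summit.AtomisticToContinuum.Crystallization.Theorems.FrustratedLawDichotomyExemptLocOpt (LocOptFails)
open Summit.AtomisticToContinuum.Crystallization.Theorems.FrustratedLawDichotomyExemptSplit (SchurElasticPricingX)
open Summit.AtomisticToContinuum.Crystallization.Theorems.FrustratedLawDichotomyExemptAbsorptionRecord
open Summit.AtomisticToContinuum.Crystallization.Theorems.FrustratedLawDichotomyCollarCensus
open Summit.AtomisticToContinuum.Crystallization.Theorems.FrustratedLawDichotomyCollarCensusKappa
open Summit.AtomisticToContinuum.Crystallization.Theorems.FrustratedLawDichotomyStrainedPatchHomSplit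
open Summit.AtomisticToContinuum.Crystallization.Theorems.FrustratedLawDichotomyStrainedPatchCleanCollar (CleanBall TailPenalty AnnularDefectFloor
  DefectiveCollarFloor tailOut)
open Summit.AtomisticToContinuum.Crystallization.Theorems.FrustratedLawDichotomyStrainedPatchPhaseCut (MonoPhaseBall AnnularPhaseFloor PolyTextureFloor)
open Summit.AtomisticToContinuum.Crystallization.Theorems.FrustratedLawDichotomyStrainedPatchCoreTube (NearHomIsoAt CoreOffTubeFloor)
open Summit.AtomisticToContinuum.Crystallization.Theorems.FrustratedLawDichotomyStrainedPatchCoreTubeRecord (CoreCoreRelief)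
open Summit.AtomisticToContinuum.Crystallization.Theorems.FrustratedLawDichotomyStrainedPatchChartFamilies (ChartBy FamilyLE familyLE_refl)
open Summit.AtomisticToContinuum.Crystallization.Theorems.FrustratedLawDichotomyStrainedPatchQuantSlaving (ChartFam SlackTab HessTab ForceTab hessBlk0)
open Summit.AtomisticToContinuum.Crystallization.Theorems.FrustratedLawDichotomyStrainedPatchHostCells (TubeFloor)
open Summit.AtomisticToContinuum.Crystallization.Theorems.FrustratedLawDichotomyStrainedPatchGradedTube
open Summit.AtomisticToContinuum.Crystallization.Theorems.FrustratedLawDichotomyStrainedPatchCoverBridge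
open Summit.AtomisticToContinuum.Crystallization.Theorems.FrustratedLawDichotomyStrainedPatchPairTube
open Summit.AtomisticToContinuum.Crystallization.Theorems.FrustratedLawDichotomyStrainedPatchHomCertTree (CertTree treeOK)
open Summit.AtomisticToContinuum.Crystallization.Theorems.FrustratedLawDichotomyStrainedPatchHomEntryGram (rootC rootW)
open Summit.AtomisticToContinuum.Crystallization.Theorems.FrustratedLawDichotomyStrainedPatchHomEntryGramHcp (rootCH rootWH)
open Summit.AtomisticToContinuum.Crystallization.Theorems.FrustratedLawDichotomyStrainedPatchHomEntryLeafHT (entryLeafOK6RBKP4 semOKH)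
open Summit.AtomisticToContinuum.Crystallization.Theorems.FrustratedLawDichotomyAperiodicGapRecordJunctionHomFloorF6pT26
open Summit.AtomisticToContinuum.Crystallization.Theorems.FrustratedLawDichotomyStrainedPatchConeAnatomy
open Summit.AtomisticToContinuum.Crystallization.Theorems.FrustratedLawDichotomyStrainedPatchStiffSector

namespace Summit.AtomisticToContinuum.Crystallization.Theorems.FrustratedLawDichotomyStrainedPatchStiffDoor

/-! ## §0. The host-sector predicates, typed (critic (a)): door · dense/dilated · deep · spectral -/

/-- (piece) [route statement · this cell; NOT a literature fact] **`Dense d`** — SOME other site of the host lies strictly within `d` of the centre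
(nearest-neighbour distance `< d`).  Record: the cone side is `Dense (26/25)`, the pair-blind side its complement (the DILATED sector 𝔄). -/
def Dense (d : ℝ) : ChartFam := fun _ z₀ c₀ => ∃ a, a ≠ c₀ ∧ dist (z₀ a) (z₀ c₀) < d

/-- The dilated sector, read positively: every other site at distance `≥ d` from the centre. [formal bookkeeping] -/
theorem not_dense_iff {d : ℝ} {M₀ : ℕ} {z₀ : Fin M₀ → E3} {c₀ : Fin M₀} : ¬Dense d M₀ z₀ c₀ ↔ ∀ a, a ≠ c₀ → d ≤ dist (z₀ a) (z₀ c₀) := by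
  simp only [Dense, not_exists, not_and, not_lt]

/-- `Dense` grows with the threshold. [formal bookkeeping] -/
theorem dense_mono {d d' : ℝ} (h : d ≤ d') : FamilyLE (Dense d) (Dense d') := fun _ _ _ ⟨a, ha, hd⟩ => ⟨a, ha, lt_of_lt_of_le hd h⟩

/-- (piece) [route statement · this cell; NOT a literature fact] **`Door d η`** — the DENSITY–MISFIT DOOR (sector 𝔇): a neighbour within `d` (closed) and an
`η`-good centre at fit scale `3/2`.  Record: `Door (24/25) (9/100)` (g94 regime map: `Λ_D ≥ 2.1` on the sample; contains FZ00/FZ62/FZ09). -/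
def Door (d η : ℝ) : ChartFam := fun _ z₀ c₀ => (∃ a, a ≠ c₀ ∧ dist (z₀ a) (z₀ c₀) ≤ d) ∧ GoodAtScale η (3 / 2) z₀ c₀

/-- A door host is dense at every larger threshold (`Door (24/25) η ≤ Dense (26/25)`). [formal bookkeeping] -/
theorem dense_of_door {d d' η : ℝ} (h : d < d') : FamilyLE (Door d η) (Dense d') := fun _ _ _ ⟨⟨a, ha, hd⟩, _⟩ => ⟨a, ha, lt_of_le_of_lt hd h⟩

/-- The door's centre is `η`-good. [formal bookkeeping] -/
theorem goodAtScale_of_door {d η : ℝ} {M₀ : ℕ} {z₀ : Fin M₀ → E3} {c₀ : Fin M₀} (h : Door d η M₀ z₀ c₀) : GoodAtScale η (3 / 2) z₀ c₀ := h.2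

/-- (piece) [route statement · this cell; NOT a literature fact] **`Deep η`** — the centre is NOT `η`-good (misfit above `η`; inside `FamP` still `≤ 1/8`):
the CLEAN-CAPPED corner of the band for `η = 21/200` (g94: L-point onset `η_c ≈ 0.108`, shuffle amplitude capped by `η_mod ≤ 1/8`; FZ12-type). -/
def Deep (η : ℝ) : ChartFam := fun _ z₀ c₀ => ¬GoodAtScale η (3 / 2) z₀ c₀

/-- A door host is not deep at its own misfit threshold. [formal bookkeeping] -/
theorem not_deep_of_door {d η : ℝ} {M₀ : ℕ} {z₀ : Fin M₀ → E3} {c₀ : Fin M₀} (h : Door d η M₀ z₀ c₀) : ¬Deep η M₀ z₀ c₀ := fun hD => hD h.2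

/-- **`quadForm H z₀ c₀ u`** — the ENERGY quadratic form of a displacement field on the host through a Hessian block table (`H = ∂F/∂y = −∇²E`, so the
energy form is `−Σ_a ⟪u a, Σ_b H(a,b) (u b)⟫`).  Designated table: `hessBlk0` (…QuantSlaving §2). -/
noncomputable def quadForm (H : HessTab) {M₀ : ℕ} (z₀ : Fin M₀ → E3) (c₀ : Fin M₀) (u : Fin M₀ → E3) : ℝ :=
  -∑ a, ⟪u a, ∑ b, H M₀ z₀ c₀ a b (u b)⟫

/-- (piece) [route statement · this cell; NOT a literature fact] **`Stiff H R Λ₀`** — the SPECTRAL sector predicate: the host's clamped-cluster energy form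
through `H` is `Λ₀`-COERCIVE on displacement fields supported in the `R`-ball about the centre (clamped exterior).  Record: `Stiff hessBlk0 (63/10) Λ₀`;
`Λ₀ ≈ 1–2` on the door by the g94 regime map (short-wave stiffness `Λ_D ≥ 2.1`; the clamped long waves are stiffer at `R = 63/10`).  This — not the door —
is the hypothesis a proof of (N|𝔇) uses; the door is its chart-readable census proxy. -/
def Stiff (H : HessTab) (R Λ₀ : ℝ) : ChartFam := fun M₀ z₀ c₀ =>
  ∀ u : Fin M₀ → E3, (∀ a, R < dist (z₀ a) (z₀ c₀) → u a = 0) → Λ₀ * ∑ a, ‖u a‖ ^ 2 ≤ quadForm H z₀ c₀ u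

/-- `Stiff` is antitone in `Λ₀`. [formal bookkeeping] -/
theorem stiff_anti {H : HessTab} {R Λ₀ Λ₁ : ℝ} (h : Λ₀ ≤ Λ₁) : FamilyLE (Stiff H R Λ₁) (Stiff H R Λ₀) :=
  fun _ _ _ hS u hu => (mul_le_mul_of_nonneg_right h (Finset.sum_nonneg fun _ _ => sq_nonneg _)).trans (hS u hu)

/-- The zero field costs nothing: `Stiff H R Λ₀` is a statement about non-trivial fields only. [formal bookkeeping] -/
theorem quadForm_zero (H : HessTab) {M₀ : ℕ} (z₀ : Fin M₀ → E3) (c₀ : Fin M₀) : quadForm H z₀ c₀ (fun _ => 0) = 0 := by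
  simp [quadForm]

/-- (piece) [route statement · this cell; NOT a literature fact] **`RecordSide H R Λ₀ ηc`** — the critic's DISJUNCTION for the record-cone side of the
dense sector (row 1567 (3)): the host is `Λ₀`-STIFF (spectral) OR its centre is DEEP (`ηc`-clean-capped: shuffle amplitude capped by `η_mod ≤ 1/8`, so
`2·A_clean − bend ≤ cone`).  Record: `RecordSide hessBlk0 (63/10) Λ₀ (21/200)`; instantiate `𝓡 :=` this in §2–§7. -/
def RecordSide (H : HessTab) (R Λ₀ ηc : ℝ) : ChartFam := fun M₀ z₀ c₀ => Stiff H R Λ₀ M₀ z₀ c₀ ∨ Deep ηc M₀ z₀ c₀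

/-- [formal bookkeeping] -/
theorem recordSide_of_stiff {H : HessTab} {R Λ₀ ηc : ℝ} : FamilyLE (Stiff H R Λ₀) (RecordSide H R Λ₀ ηc) := fun _ _ _ h => Or.inl h

/-- [formal bookkeeping] -/
theorem recordSide_of_deep {H : HessTab} {R Λ₀ ηc : ℝ} : FamilyLE (Deep ηc) (RecordSide H R Λ₀ ηc) := fun _ _ _ h => Or.inr h

/-- ★ «DOOR-STIFF»: the census proxy MEETS the spectral predicate — `FamilyLE (famAnd 𝓘 (Door d η)) (Stiff H R Λ₀)`: every `𝓘`-host in the door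
`(d, η)` is `Λ₀`-stiff.  Record «DOOR-STIFF-95»: `FamilyLE (famAnd FamP (Door (24/25) (9/100))) (Stiff hessBlk0 (63/10) Λ₀)` [CERTIFICATE · INSTRUMENTABLE:
interval lower bound of the clamped `63/10`-ball Hessian form over the door host boxes; g94 sample: short-wave `Λ_D ≥ 2.1` there].  Once certified, the
door lands on the record side. [formal bookkeeping] -/
theorem door_le_recordSide {𝓘 : ChartFam} {d η : ℝ} {H : HessTab} {R Λ₀ ηc : ℝ} (h : FamilyLE (famAnd 𝓘 (Door d η)) (Stiff H R Λ₀)) :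
    FamilyLE (famAnd 𝓘 (Door d η)) (RecordSide H R Λ₀ ηc) := fun M₀ z₀ c₀ hx => Or.inl (h M₀ z₀ c₀ hx)

/-- … and so does the deep corner of any class. [formal bookkeeping] -/
theorem deep_le_recordSide {𝓘 : ChartFam} {H : HessTab} {R Λ₀ ηc : ℝ} : FamilyLE (famAnd 𝓘 (Deep ηc)) (RecordSide H R Λ₀ ηc) :=
  fun _ _ _ hx => Or.inr hx.2

/-! ## §1. The first lemma of (N|𝔇) (critic (c)): linear response with explicit `Λ₀` -/

section Response

variable {M₀ : ℕ}

/-- ★ COERCIVITY ⟹ A-PRIORI BOUND (finite-dimensional Lax–Milgram by Cauchy–Schwarz): `Λ₀·Σ‖u a‖² ≤ Σ⟪u a, g a⟫` gives `Λ₀²·Σ‖u a‖² ≤ Σ‖g a‖²`. [folklore] -/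
theorem sq_sum_le_of_coercive {Λ₀ : ℝ} {u g : Fin M₀ → E3} (hΛ : 0 < Λ₀) (h : Λ₀ * ∑ a, ‖u a‖ ^ 2 ≤ ∑ a, ⟪u a, g a⟫) :
    Λ₀ ^ 2 * ∑ a, ‖u a‖ ^ 2 ≤ ∑ a, ‖g a‖ ^ 2 := by
  have hS0 : 0 ≤ ∑ a, ‖u a‖ ^ 2 := Finset.sum_nonneg fun a _ => sq_nonneg _
  have hG0 : 0 ≤ ∑ a, ‖g a‖ ^ 2 := Finset.sum_nonneg fun a _ => sq_nonneg _
  have h1 : ∑ a, ⟪u a, g a⟫ ≤ ∑ a, ‖u a‖ * ‖g a‖ := Finset.sum_le_sum fun a _ => real_inner_le_norm _ _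
  have h2 : (∑ a, ‖u a‖ * ‖g a‖) ^ 2 ≤ (∑ a, ‖u a‖ ^ 2) * ∑ a, ‖g a‖ ^ 2 := Finset.sum_mul_sq_le_sq_mul_sq _ _ _
  have hΛS : Λ₀ * ∑ a, ‖u a‖ ^ 2 ≤ ∑ a, ‖u a‖ * ‖g a‖ := h.trans h1
  have h3 : (Λ₀ * ∑ a, ‖u a‖ ^ 2) * (Λ₀ * ∑ a, ‖u a‖ ^ 2) ≤ (∑ a, ‖u a‖ * ‖g a‖) * ∑ a, ‖u a‖ * ‖g a‖ :=
    mul_self_le_mul_self (mul_nonneg hΛ.le hS0) hΛS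
  rcases hS0.eq_or_lt with hS | hS
  · rw [← hS]; simpa using hG0
  · have h4 : Λ₀ ^ 2 * (∑ a, ‖u a‖ ^ 2) * ∑ a, ‖u a‖ ^ 2 ≤ (∑ a, ‖g a‖ ^ 2) * ∑ a, ‖u a‖ ^ 2 := by nlinarith [h2, h3]
    exact le_of_mul_le_mul_right h4 hS

variable {H : HessTab} {R Λ₀ : ℝ} {z₀ : Fin M₀ → E3} {c₀ : Fin M₀} {u g : Fin M₀ → E3}

/-- ★★ **THE LINEAR-RESPONSE LAW with explicit `Λ₀`** (BASIN-87's linear term, ℓ² form): on a `Λ₀`-stiff host, an `R`-ball-supported displacement field whose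
LINEAR force balances the residual force `g` (`Σ_b H(a,b) (u b) = −g a`; in the application `‖g a‖ ≤ σ₁·(1 + X̄)`: the cluster's capped force, the host's
own force and the second-order remainder) satisfies `Λ₀²·Σ_a ‖u a‖² ≤ Σ_a ‖g a‖²` — the ℓ² GAIN is `1/Λ₀`. [folklore] -/
theorem linearResponse_l2 (hP : Stiff H R Λ₀ M₀ z₀ c₀) (hΛ : 0 < Λ₀) (hu : ∀ a, R < dist (z₀ a) (z₀ c₀) → u a = 0)
    (heq : ∀ a, ∑ b, H M₀ z₀ c₀ a b (u b) = -g a) : Λ₀ ^ 2 * ∑ a, ‖u a‖ ^ 2 ≤ ∑ a, ‖g a‖ ^ 2 := by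
  have h := hP u hu
  simp only [quadForm, heq, inner_neg_right, Finset.sum_neg_distrib, neg_neg] at h
  exact sq_sum_le_of_coercive hΛ h

/-- … read at ONE site: `Λ₀²·‖u a‖² ≤ Σ_b ‖g b‖²` — the sup bound the pair clause consumes, LOSSY by the site count (the ℓ^∞ gain of `H⁻¹`, i.e. the
decay of the lattice Green's function of a coercive banded `H`, is the next lemma of the line and is NOT claimed here). [folklore] -/
theorem linearResponse_site (hP : Stiff H R Λ₀ M₀ z₀ c₀) (hΛ : 0 < Λ₀) (hu : ∀ a, R < dist (z₀ a) (z₀ c₀) → u a = 0)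
    (heq : ∀ a, ∑ b, H M₀ z₀ c₀ a b (u b) = -g a) (a : Fin M₀) : Λ₀ ^ 2 * ‖u a‖ ^ 2 ≤ ∑ b, ‖g b‖ ^ 2 :=
  (mul_le_mul_of_nonneg_left (Finset.single_le_sum (f := fun b => ‖u b‖ ^ 2) (fun _ _ => sq_nonneg _) (Finset.mem_univ a)) (sq_nonneg Λ₀)).trans
    (linearResponse_l2 hP hΛ hu heq)

/-- ★ THE ONE-MODE READING (frozen zone-boundary phonon; g94 §2.4 from the sufficient side): `n` sites of amplitude `A` against a per-site force cap `σ`,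
`Λ₀²·(n·A²) ≤ n·σ²` ⟹ `A ≤ σ/Λ₀` — so the odd-bond deviation `2A ≤ 2σ/Λ₀`, the N94 floor `2σ₁/Λ_D` of the necessary side. [formal bookkeeping] -/
theorem amplitude_le_of_sq {Λ A σ n : ℝ} (hΛ : 0 < Λ) (hσ : 0 ≤ σ) (hn : 0 < n) (h : Λ ^ 2 * (n * A ^ 2) ≤ n * σ ^ 2) : A ≤ σ / Λ := by
  rw [le_div_iff₀ hΛ]
  have h' : Λ ^ 2 * A ^ 2 ≤ σ ^ 2 := by
    have : (Λ ^ 2 * A ^ 2) * n ≤ σ ^ 2 * n := by nlinarith [h]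
    exact le_of_mul_le_mul_right this hn
  nlinarith [h', hσ, hΛ, sq_nonneg (A * Λ - σ), sq_nonneg (A * Λ + σ)]


/-! ### §1b. The BOND-gradient form (what the pair clause measures): Korn-type stiffness `Λ₁` and the H⁻¹–H¹ response -/

/-- **`gradSq ℓ z₀ u`** — the bond-gradient energy `Σ_{a ≠ b, |z₀a − z₀b| ≤ ℓ} ‖u a − u b‖²` (ordered pairs; bonds to clamped sites included, so it
dominates `Σ‖u a‖²` by a discrete Poincaré constant on ball-supported fields). -/
noncomputable def gradSq (ℓ : ℝ) (z₀ : Fin M₀ → E3) (u : Fin M₀ → E3) : ℝ :=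
  ∑ a, ∑ b, if dist (z₀ a) (z₀ b) ≤ ℓ ∧ a ≠ b then ‖u a - u b‖ ^ 2 else 0

/-- [formal bookkeeping] -/
theorem gradSq_nonneg (ℓ : ℝ) (z₀ : Fin M₀ → E3) (u : Fin M₀ → E3) : 0 ≤ gradSq ℓ z₀ u :=
  Finset.sum_nonneg fun _ _ => Finset.sum_nonneg fun _ _ => by split_ifs <;> positivity

/-- One bond is dominated by the bond-gradient energy. [formal bookkeeping] -/
theorem bond_sq_le_gradSq {ℓ : ℝ} {z₀ u : Fin M₀ → E3} {a b : Fin M₀} (hd : dist (z₀ a) (z₀ b) ≤ ℓ) (hab : a ≠ b) :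
    ‖u a - u b‖ ^ 2 ≤ gradSq ℓ z₀ u := by
  unfold gradSq
  refine le_trans ?_ (Finset.single_le_sum (f := fun a' => ∑ b', if dist (z₀ a') (z₀ b') ≤ ℓ ∧ a' ≠ b' then ‖u a' - u b'‖ ^ 2 else 0)
    (fun a' _ => Finset.sum_nonneg fun b' _ => by split_ifs <;> positivity) (Finset.mem_univ a))
  refine le_trans ?_ (Finset.single_le_sum (f := fun b' => if dist (z₀ a) (z₀ b') ≤ ℓ ∧ a ≠ b' then ‖u a - u b'‖ ^ 2 else 0)
    (fun b' _ => by split_ifs <;> positivity) (Finset.mem_univ b))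
  rw [if_pos ⟨hd, hab⟩]

/-- (piece) [route statement · this cell; NOT a literature fact] **`StiffGrad H R ℓ Λ₁`** — the KORN-type sector predicate: on `R`-ball-supported fields the
energy form dominates `Λ₁ ×` the `ℓ`-bond-gradient energy (`H ≥ Λ₁ · L_ℓ ⊗ 1`, `L_ℓ` the bond-graph Laplacian).  It is what the PAIR clause needs (bond
deviations, not displacements).  Desk values «LAMBDA-95» (`g95/num/lambda95b.out`, homogeneous fcc host, tree potential, `ℓ` = first shell, Bloch:
`Λ₁ = min_k λ_min D(k) / μ_nn(k)`): `d = 0.92: 2.12 · 0.94: 1.52 · 0.96: 1.10 · 0.98: 0.79 · 1.00: 0.57 · 1.02: 0.41 · 1.04: 0.29 · 1.06: 0.21 · 1.07: 0.09 ·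
1.08: < 0` — the binding mode is the LONG-WAVE slow transverse `[110]` branch (`C′`), which goes ELASTICALLY UNSTABLE at `d ≈ 1.075`: the soft/dilated sector
of SHUFFLE-94 is the shear-unstable dilated crystal; zone-boundary modes are `20–50×` stiffer on the door. -/
def StiffGrad (H : HessTab) (R ℓ Λ₁ : ℝ) : ChartFam := fun M₀ z₀ c₀ =>
  ∀ u : Fin M₀ → E3, (∀ a, R < dist (z₀ a) (z₀ c₀) → u a = 0) → Λ₁ * gradSq ℓ z₀ u ≤ quadForm H z₀ c₀ u

/-- ★★ **BOND RESPONSE with explicit `Λ₁`** (the pair-clause form of BASIN-87's linear term): on a `Λ₁`-Korn-stiff host, linear force balance against a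
residual force `g` whose `H⁻¹`-type pairing with the response is controlled by the bond-gradient energy, `(Σ⟪u a, g a⟫)² ≤ Ψ₂·gradSq` (`Ψ₂ = ` the squared
dual (graph-`H⁻¹`) seminorm of `g`; for a frozen zone-boundary pattern `Ψ₂ = ‖g‖²/μ(k_X) = ‖g‖²/16`), gives `Λ₁²·gradSq ≤ Ψ₂`. [folklore] -/
theorem gradResponse_l2 {ℓ Λ₁ Ψ₂ : ℝ} (hP : StiffGrad H R ℓ Λ₁ M₀ z₀ c₀) (hΛ : 0 < Λ₁) (hu : ∀ a, R < dist (z₀ a) (z₀ c₀) → u a = 0)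
    (heq : ∀ a, ∑ b, H M₀ z₀ c₀ a b (u b) = -g a) (hΨ : 0 ≤ Ψ₂) (hg : (∑ a, ⟪u a, g a⟫) ^ 2 ≤ Ψ₂ * gradSq ℓ z₀ u) :
    Λ₁ ^ 2 * gradSq ℓ z₀ u ≤ Ψ₂ := by
  have hS0 := gradSq_nonneg ℓ z₀ u
  have h := hP u hu
  simp only [quadForm, heq, inner_neg_right, Finset.sum_neg_distrib, neg_neg] at h
  have h2 := mul_self_le_mul_self (mul_nonneg hΛ.le hS0) h
  rcases hS0.eq_or_lt with h0 | hpos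
  · rw [← h0]; simpa using hΨ
  · have h3 : Λ₁ ^ 2 * gradSq ℓ z₀ u * gradSq ℓ z₀ u ≤ Ψ₂ * gradSq ℓ z₀ u := by nlinarith [h2, hg]
    exact le_of_mul_le_mul_right h3 hpos

/-- … read on ONE bond: `Λ₁²·‖u a − u b‖² ≤ Ψ₂` — the explicit-constant bound on the quantity the record cone measures. [folklore] -/
theorem bondResponse {ℓ Λ₁ Ψ₂ : ℝ} (hP : StiffGrad H R ℓ Λ₁ M₀ z₀ c₀) (hΛ : 0 < Λ₁) (hu : ∀ a, R < dist (z₀ a) (z₀ c₀) → u a = 0)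
    (heq : ∀ a, ∑ b, H M₀ z₀ c₀ a b (u b) = -g a) (hΨ : 0 ≤ Ψ₂) (hg : (∑ a, ⟪u a, g a⟫) ^ 2 ≤ Ψ₂ * gradSq ℓ z₀ u)
    {a b : Fin M₀} (hd : dist (z₀ a) (z₀ b) ≤ ℓ) (hab : a ≠ b) : Λ₁ ^ 2 * ‖u a - u b‖ ^ 2 ≤ Ψ₂ :=
  (mul_le_mul_of_nonneg_left (bond_sq_le_gradSq hd hab) (sq_nonneg Λ₁)).trans (gradResponse_l2 hP hΛ hu heq hΨ hg)

end Response

end Summit.AtomisticToContinuum.Crystallization.Theorems.FrustratedLawDichotomyStrainedPatchStiffDoor
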